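import Summits.AnomalousDissipation.AnomalousDissipation.Theorems.SawtoothPulseCascadeK1LocalisedCascadeHCertSum
import Summits.AnomalousDissipation.AnomalousDissipation.Theorems.SawtoothPulseCascadeK1LocalisedCascadeVTwistBlocksC
import Summits.AnomalousDissipation.AnomalousDissipation.Theorems.SawtoothPulseCascadeK1LocalisedCascadeVOJunkFrame
import Summits.AnomalousDissipation.AnomalousDissipation.Theorems.SawtoothPulseCascadeK1LocalisedCascadePhaseOneJunkSplit
import Summits.AnomalousDissipation.AnomalousDissipation.Theorems.SawtoothPulseCascadeK1LocalisedCascadePhaseOneHSum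
import Summits.AnomalousDissipation.AnomalousDissipation.Theorems.SawtoothPulseCascadeK1LocalisedCascadePhaseOneTails

/-!
# K1loc explicit start: THE V/O JUNK AND THE CERTIFIED SIZE `E₂` OF THE PHASE-2 START («VOJunkBound»)

Helper file of the prover lane on the crux `K1LocalisedCascade` (stmt-AnomalousDissipation-19491), route `SawtoothPulseCascade`
(arbiter A24-6/A24-7, K1LOC-LEDGER row 1).  Assembly of the lane's chain:
* `hrem_total`: the source remainders of the 801 H-fibres add up to at most `R_tot = 176/10⁷`
  (`…PhaseOneHSum.sum_fibre_lineCompl_le_tsum` + `…PhaseOneTails.phaseOne_vRemainder_le` at `Q_c = 100`);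
* **`vo_junk_le`**: `j_V + j_O ≤ 0.01496` — `…VOJunkFrame.vo_junk_le_of_fibre_certs` with the three-level tube weights
  `u = ℓ`, the V-twist class bound `Γ = (467/45)φ` (`…VTwistBlocksC.vtwist_classBound`, `γ₀` from `vtwist_gamma0_le`), the
  fibre functional itself as `V` and the certified sum `…HCertSum.hcertAll` (`Σ_p V_p ≤ 0.002699892380444899918 + 6.403·R_tot`),
  `t = 13/10`, `s = 1/700`;
* **`phaseTwo_start_E2_le`**: the certified phase-2 start size
  `E₂ = S₂(800) + O₂(800; (1,4)) ≤ 8/625 + 29/10⁴ + 0.01496 = 0.03066` (`…PhaseOneJunkSplit.phaseTwo_start20_le_of_junk` with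
  `K′ = 120`, `j_H ≤ 29/10⁴` of `…PhaseOneHSum.phaseOne_jH_le`).
No definitions; nothing about the crux beyond these helper inequalities. [cite: Grafakos2014, Prop. 3.1.2 (5), Prop. 3.2.7 (3)] [problem: turb]
-/

-- `Summit.<Summit>.<Problem>`: single-conjunct summit, the duplicate namespace segment is deliberate.
set_option linter.dupNamespace false
set_option maxRecDepth 4000

noncomputable section

namespace Summit.AnomalousDissipation.AnomalousDissipation.Theorems.SawtoothPulseCascade.K1Start

open MeasureTheory Filter Topology UnitAddTorus Complex AddCircle
open scoped Real
open Literature.Analysis Literature.Analysis.FunctionSpaces Literature.Analysis.FunctionSpaces.Torus Literature.Analysis.FluidPDE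
open Literature.Analysis.FluidPDE.ShearStage
open Literature.Analysis.FluidPDE.SawtoothCascade Literature.Analysis.FluidPDE.SawtoothCascade.CascadeParams
open Summit.AnomalousDissipation.AnomalousDissipation.Theorems.SawtoothPulseCascade.K1Window

section Cascade

variable (P : CascadeParams) (hγ : P.γ = 8) (hN₀ : P.N₀ = 1) (hρN : P.ρN = 2) (hd : P.d = 2) (hδ₀ : 0 < P.δ₀)
  (hδ₀' : P.δ₀ ≤ (2 : ℝ)⁻¹ ^ 30) (a b : ℕ → UnitAddTorus (Fin 2) → ℝ) (h0 : a 0 = datum)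
  (hb : ∀ j, b j = a j ∘ shearMap 0 1 (amp ⟨P.U j, P.U_periodic j, P.contDiff_U (P.δ_pos hδ₀ (by rw [hd]; norm_num) j)⟩ P.γ))
  (hab : ∀ j, a (j + 1) = b j ∘ shearMap 1 0 (amp ⟨P.U j, P.U_periodic j, P.contDiff_U (P.δ_pos hδ₀ (by rw [hd]; norm_num) j)⟩ P.γ))

include hγ hN₀ hρN hd hδ₀' h0 hb hab

omit hρN in
/-- **Total source remainder**: `Σ_{p∈[−400,400]} R_p ≤ 176/10⁷` at `Q_c = 100`. [cite: Grafakos2014, Prop. 3.2.7 (3)] -/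
theorem hrem_total :
    ∑ p ∈ Finset.Icc (-400 : ℤ) 400, ∑' q : ℤ, (if q ∈ (Finset.Icc (-(100 : ℤ)) 100).filter (fun q => 1 ≤ |q|) then 0
          else ‖mFourierCoeff (fun x => (a 1 x : ℂ)) ![p, q]‖ ^ 2) ≤ 176 / 10 ^ 7 := by
  classical
  have hd' : 0 < P.d := by rw [hd]; norm_num
  set ψ₀ : ShearProfile := amp ⟨P.U 0, P.U_periodic 0, P.contDiff_U (P.δ_pos hδ₀ hd' 0)⟩ P.γ with hψ₀
  have hb0 : b 0 = datum ∘ shearMap 0 1 ψ₀ := by rw [hb 0, h0]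
  have ha1 : a 1 = b 0 ∘ shearMap 1 0 ψ₀ := hab 0
  have ha1s : IsSmooth (a 1) := ha1 ▸ hb0 ▸ (isSmooth_datum_comp_shearMap ψ₀).comp_shearMap 1 0 ψ₀
  have hθc : Continuous (fun x => (a 1 x : ℂ)) := Complex.continuous_ofReal.comp ha1s.continuous
  obtain ⟨c, hc⟩ : ∃ c : (Fin 2 → ℤ) → ℝ, ∀ k, c k = ‖mFourierCoeff (fun x => (a 1 x : ℂ)) k‖ ^ 2 := ⟨_, fun _ => rfl⟩
  have hcs : Summable c := (funext hc : c = _) ▸ (hasSum_sq_mFourierCoeff_of_continuous hθc).summable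
  have hc0 : ∀ k, 0 ≤ c k := fun k => by rw [hc]; exact sq_nonneg _
  simp only [← hc]
  have h1 := sum_fibre_lineCompl_le_tsum c hcs hc0 (Finset.Icc (-400 : ℤ) 400)
    ((Finset.Icc (-(100 : ℤ)) 100).filter (fun q => 1 ≤ |q|))
  have h2 := phaseOne_vRemainder_le P hγ hN₀ hδ₀ hδ₀' hd' a b h0 (hb 0) (hab 0) 100 (by norm_num)
  simp only [← hc] at h2
  have h4 : (Real.sqrt (2 * (2 * |((8 : ℤ) : ℝ)| * 0.31831) ^ 2 * ((((100 + 1 : ℕ) : ℝ)) ^ 2 /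
      (((100 + 1 : ℕ) : ℝ) ^ 2 - ((8 : ℤ) : ℝ) ^ 2)) ^ 2 / (3 * (((100 + 1 : ℕ) : ℝ) - 2) * (((100 + 1 : ℕ) : ℝ) - 1) *
      ((100 + 1 : ℕ) : ℝ))) + (2 : ℝ)⁻¹ ^ 25) ^ 2 ≤ 176 / 10 ^ 7 := by
    have hY : 2 * (2 * |((8 : ℤ) : ℝ)| * 0.31831) ^ 2 * ((((100 + 1 : ℕ) : ℝ)) ^ 2 /
        (((100 + 1 : ℕ) : ℝ) ^ 2 - ((8 : ℤ) : ℝ) ^ 2)) ^ 2 / (3 * (((100 + 1 : ℕ) : ℝ) - 2) * (((100 + 1 : ℕ) : ℝ) - 1) *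
        ((100 + 1 : ℕ) : ℝ)) ≤ (0.0041849 : ℝ) ^ 2 := by
      rw [show |((8 : ℤ) : ℝ)| = 8 by norm_num]
      norm_num
    have hs : Real.sqrt (2 * (2 * |((8 : ℤ) : ℝ)| * 0.31831) ^ 2 * ((((100 + 1 : ℕ) : ℝ)) ^ 2 /
        (((100 + 1 : ℕ) : ℝ) ^ 2 - ((8 : ℤ) : ℝ) ^ 2)) ^ 2 / (3 * (((100 + 1 : ℕ) : ℝ) - 2) * (((100 + 1 : ℕ) : ℝ) - 1) *
        ((100 + 1 : ℕ) : ℝ))) ≤ 0.0041849 :=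
      (Real.sqrt_le_sqrt hY).trans (by rw [Real.sqrt_sq (by norm_num)])
    have hs0 := Real.sqrt_nonneg (2 * (2 * |((8 : ℤ) : ℝ)| * 0.31831) ^ 2 * ((((100 + 1 : ℕ) : ℝ)) ^ 2 /
        (((100 + 1 : ℕ) : ℝ) ^ 2 - ((8 : ℤ) : ℝ) ^ 2)) ^ 2 / (3 * (((100 + 1 : ℕ) : ℝ) - 2) * (((100 + 1 : ℕ) : ℝ) - 1) *
        ((100 + 1 : ℕ) : ℝ)))
    nlinarith
  have hiff : ∀ x : ℤ, x ∈ (Finset.Icc (-(100 : ℤ)) 100).filter (fun q => 1 ≤ |q|) ↔ 1 ≤ |x| ∧ |x| ≤ ((100 : ℕ) : ℤ) := by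
    intro x
    rw [Finset.mem_filter, Finset.mem_Icc, Nat.cast_ofNat, abs_le]
    constructor
    · rintro ⟨h₁, h₂⟩; exact ⟨h₂, h₁⟩
    · rintro ⟨h₁, h₂⟩; exact ⟨h₂, h₁⟩
  have h3 : ∑' k : Fin 2 → ℤ, (if k 1 ∈ (Finset.Icc (-(100 : ℤ)) 100).filter (fun q => 1 ≤ |q|) then (0 : ℝ) else 1) * c k ≤
      176 / 10 ^ 7 := by
    refine le_trans (le_of_eq (tsum_congr fun k => ?_)) (h2.trans ?_)
    · by_cases hk : 1 ≤ |k 1| ∧ |k 1| ≤ ((100 : ℕ) : ℤ)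
      · rw [if_pos hk, if_pos ((hiff _).2 hk)]
      · rw [if_neg hk, if_neg (mt (hiff _).1 hk)]
    · exact h4
  exact h1.trans h3

/-- **The V/O junk of the explicit phase-2 start**: `j_V + j_O ≤ 0.01496` (three-level tube Cauchy–Schwarz split by source classes,
V-twist class bound `(467/45)φ`, certified H-fibre sum `0.002699892380444899918 + 6.403·R_tot`, `t = 13/10`, `s = 1/700`).
[cite: Grafakos2014, Prop. 3.1.2 (5), Prop. 3.2.7 (3)] -/
theorem vo_junk_le :
    ∑' k : Fin 2 → ℤ, (if (120 : ℤ) ≤ |k 1| ∧ |k 0| < 800 then (1 : ℝ) else 0) * ‖mFourierCoeff (fun x => (a 2 x : ℂ)) k‖ ^ 2 +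
        ∑' k : Fin 2 → ℤ, (if (800 : ℤ) ≤ |k 0| ∧ |k 0| ≤ 4 * |k 1| then (1 : ℝ) else 0) *
          ‖mFourierCoeff (fun x => (a 2 x : ℂ)) k‖ ^ 2 ≤ 0.01496 := by
  have hV := vo_junk_le_of_fibre_certs P hγ hN₀ hρN hd hδ₀ hδ₀' a b h0 hb hab
    (fun n p => (if |(|n| - 8 * |p|)| ≤ 24 then (1 : ℝ) else if |(|n| - 8 * |p|)| ≤ 56 then 2 / 5 else 1 / 9))
    (fun n p => by split_ifs <;> norm_num) (fun n p => by split_ifs <;> norm_num)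
    (fun n => 467 / 45 * (if ((|n|) : ℝ) < 200 then 0.0396607 / (((|n|) : ℝ) - 108.5) else 0.0768758 / (((|n|) : ℝ) - 22))) (γ₀ := 467 / 45 * (0.0768758 / 3578)) (by norm_num)
    (fun n hn => vtwist_gamma0_le n hn) (fun n hn r hr => vtwist_classBound n hn r hr)
    (fun p : ℤ => ∑ n ∈ ((Finset.Icc (-3600 : ℤ) 3600).filter (fun n => 120 ≤ |n|)).filter (fun n => |(8 * |p| - |n|)| < 400),
      467 / 45 * (if ((|n|) : ℝ) < 200 then 0.0396607 / (((|n|) : ℝ) - 108.5) else 0.0768758 / (((|n|) : ℝ) - 22)) /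
          (if |(|n| - 8 * |p|)| ≤ 24 then (1 : ℝ) else if |(|n| - 8 * |p|)| ≤ 56 then 2 / 5 else 1 / 9) *
        ‖mFourierCoeff (fun x => (b 1 x : ℂ)) ![p, n]‖ ^ 2)
    (fun p _ => le_rfl) (t := 13 / 10) (s := 1 / 700) (by norm_num) (by norm_num)
  have hA : ∑ p ∈ Finset.Icc (-400 : ℤ) 400, ∑ n ∈ ((Finset.Icc (-3600 : ℤ) 3600).filter (fun n => 120 ≤ |n|)).filter (fun n => |(8 * |p| - |n|)| < 400),
      467 / 45 * (if ((|n|) : ℝ) < 200 then 0.0396607 / (((|n|) : ℝ) - 108.5) else 0.0768758 / (((|n|) : ℝ) - 22)) /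
          (if |(|n| - 8 * |p|)| ≤ 24 then (1 : ℝ) else if |(|n| - 8 * |p|)| ≤ 56 then 2 / 5 else 1 / 9) *
        ‖mFourierCoeff (fun x => (b 1 x : ℂ)) ![p, n]‖ ^ 2 ≤
      0.002699892380444899918 + 6.403 * ∑ p ∈ Finset.Icc (-400 : ℤ) 400, ∑' q : ℤ, (if q ∈ (Finset.Icc (-(100 : ℤ)) 100).filter (fun q => 1 ≤ |q|) then 0
          else ‖mFourierCoeff (fun x => (a 1 x : ℂ)) ![p, q]‖ ^ 2) :=
    hcertAll P hγ hN₀ hρN hd hδ₀ hδ₀' a b h0 hb hab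
  have hR := hrem_total P hγ hN₀ hd hδ₀ hδ₀' a b h0 hb hab
  have hW : ∑ p ∈ Finset.Icc (-400 : ℤ) 400, ∑ n ∈ ((Finset.Icc (-3600 : ℤ) 3600).filter (fun n => 120 ≤ |n|)).filter (fun n => |(8 * |p| - |n|)| < 400),
      467 / 45 * (if ((|n|) : ℝ) < 200 then 0.0396607 / (((|n|) : ℝ) - 108.5) else 0.0768758 / (((|n|) : ℝ) - 22)) /
          (if |(|n| - 8 * |p|)| ≤ 24 then (1 : ℝ) else if |(|n| - 8 * |p|)| ≤ 56 then 2 / 5 else 1 / 9) *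
        ‖mFourierCoeff (fun x => (b 1 x : ℂ)) ![p, n]‖ ^ 2 ≤ 0.002812585180444899918 := by
    have := mul_le_mul_of_nonneg_left hR (show (0 : ℝ) ≤ 6.403 by norm_num)
    linarith
  have hC : (0 : ℝ) ≤ 1 + 13 / 10 + (1 + 1 / (13 / 10)) * (1 + 1 / (1 / 700)) * ((2 : ℝ)⁻¹ ^ 27 * 3600) ^ 2 /
      (467 / 45 * (0.0768758 / 3578)) := by norm_num
  refine hV.trans ?_
  refine (add_le_add (mul_le_mul_of_nonneg_left hW hC) le_rfl).trans ?_
  norm_num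

/-- **Certified phase-2 start size** (K1LOC-LEDGER row 1): `E₂ = S₂(800) + O₂(800; (1,4)) ≤ 8/625 + 29/10⁴ + 0.01496 = 0.03066`.
[cite: Grafakos2014, Prop. 3.1.2 (5), Prop. 3.2.7 (3)] -/
theorem phaseTwo_start_E2_le :
    ∑' k : Fin 2 → ℤ, (if |k 0| < ((800 : ℕ) : ℤ) then (1 : ℝ) else 0) * ‖mFourierCoeff (fun x => (a 2 x : ℂ)) k‖ ^ 2 +
        ∑' k : Fin 2 → ℤ, (if ((800 : ℕ) : ℤ) ≤ |k 0| ∧ ((1 : ℕ) : ℤ) * |k 0| ≤ ((4 : ℕ) : ℤ) * |k 1| then (1 : ℝ) else 0) *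
          ‖mFourierCoeff (fun x => (a 2 x : ℂ)) k‖ ^ 2 ≤ 0.03066 := by
  have hd' : 0 < P.d := by rw [hd]; norm_num
  have hJ := vo_junk_le P hγ hN₀ hρN hd hδ₀ hδ₀' a b h0 hb hab
  have i1 : ∀ x y : ℤ, (((120 : ℕ) : ℤ) ≤ |y| ∧ |x| < ((800 : ℕ) : ℤ)) ↔ ((120 : ℤ) ≤ |y| ∧ |x| < 800) := fun x y => by
    constructor <;> rintro ⟨h₁, h₂⟩ <;> constructor <;> omega
  have i2 : ∀ x y : ℤ, (((800 : ℕ) : ℤ) ≤ |x| ∧ ((1 : ℕ) : ℤ) * |x| ≤ ((4 : ℕ) : ℤ) * |y|) ↔ ((800 : ℤ) ≤ |x| ∧ |x| ≤ 4 * |y|) :=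
    fun x y => by constructor <;> rintro ⟨h₁, h₂⟩ <;> constructor <;> omega
  have e1 : ∑' k : Fin 2 → ℤ, (if ((120 : ℕ) : ℤ) ≤ |k 1| ∧ |k 0| < ((800 : ℕ) : ℤ) then (1 : ℝ) else 0) *
      ‖mFourierCoeff (fun x => (a 2 x : ℂ)) k‖ ^ 2 =
      ∑' k : Fin 2 → ℤ, (if (120 : ℤ) ≤ |k 1| ∧ |k 0| < 800 then (1 : ℝ) else 0) * ‖mFourierCoeff (fun x => (a 2 x : ℂ)) k‖ ^ 2 := by
    refine tsum_congr fun k => ?_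
    by_cases hk : (120 : ℤ) ≤ |k 1| ∧ |k 0| < 800
    · rw [if_pos hk, if_pos ((i1 _ _).2 hk)]
    · rw [if_neg hk, if_neg (mt (i1 _ _).1 hk)]
  have e2 : ∑' k : Fin 2 → ℤ, (if ((800 : ℕ) : ℤ) ≤ |k 0| ∧ ((1 : ℕ) : ℤ) * |k 0| ≤ ((4 : ℕ) : ℤ) * |k 1| then (1 : ℝ) else 0) *
      ‖mFourierCoeff (fun x => (a 2 x : ℂ)) k‖ ^ 2 =
      ∑' k : Fin 2 → ℤ, (if (800 : ℤ) ≤ |k 0| ∧ |k 0| ≤ 4 * |k 1| then (1 : ℝ) else 0) * ‖mFourierCoeff (fun x => (a 2 x : ℂ)) k‖ ^ 2 := by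
    refine tsum_congr fun k => ?_
    by_cases hk : (800 : ℤ) ≤ |k 0| ∧ |k 0| ≤ 4 * |k 1|
    · rw [if_pos hk, if_pos ((i2 _ _).2 hk)]
    · rw [if_neg hk, if_neg (mt (i2 _ _).1 hk)]
  have h := phaseTwo_start20_le_of_junk P hγ hN₀ hδ₀ hδ₀' hd' a b h0 hb hab 120 (jH := 29 / 10 ^ 4)
    (jV := ∑' k : Fin 2 → ℤ, (if (120 : ℤ) ≤ |k 1| ∧ |k 0| < 800 then (1 : ℝ) else 0) * ‖mFourierCoeff (fun x => (a 2 x : ℂ)) k‖ ^ 2)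
    (jO := 0.01496 - ∑' k : Fin 2 → ℤ, (if (120 : ℤ) ≤ |k 1| ∧ |k 0| < 800 then (1 : ℝ) else 0) * ‖mFourierCoeff (fun x => (a 2 x : ℂ)) k‖ ^ 2)
    (phaseOne_jH_le P hγ hN₀ hρN hd hδ₀ hδ₀' a b h0 hb hab) (by rw [e1]) (by rw [e2]; linarith)
  linarith

end Cascade

end Summit.AnomalousDissipation.AnomalousDissipation.Theorems.SawtoothPulseCascade.K1Start
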